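import Mathlib.Topology.Order.Compact
import Mathlib.Order.ConditionallyCompleteLattice.Basic
import Literature.Analysis.Calculus.SecondDividedDifference
import HarnessLib

/-!
# Interpolation forms for the range of a univariate function (Neumaier 1990, §2.4)

A. Neumaier, *Interval Methods for Systems of Equations*, Cambridge University Press 1990,
§2.4 "Interpolation forms" (book pp. 66–71). [`Neumaier1991`]

For `f : D ⊆ ℝ → ℝ`, an approximating function `p`, an error function `e` and a (thick or thin)
interval `x = [x̲, x̄]`, the standing hypothesis of the section is the decomposition

  (1) `f(x̃) = p(x̃) + c̃ e(x̃)` for some `c̃ ∈ c = [c̲, c̄]`, for all `x̃ ∈ x`,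

and the *interpolation form* is

  (2) `f_p(x) := □(p*(x, c̲) ∪ p*(x, c̄))`, where (3) `p(x̃, c̃) := p(x̃) + c̃ e(x̃)`

and `p*(x, c̃)` is the range of `p(·, c̃)` over `x`.

* **Theorem 2.4.1.** If (1) holds then (4) `f*(x) ⊆ f_p(x)`; (5)
  `q(f_p(x), f*(x)) ≤ 2·rad(c)|e*(x)|`; and (6) if `e*(x) ≤ 0` then
  `f_p(x) = [inf p*(x, c̄), sup p*(x, c̲)]`.
* **Theorem 2.4.2 (parabolic boundary value form).** For a thick `x`, suppose
  (9) `f[x̲, x̄, x̃] ∈ c` for all `x̃ ∈ int(x)`. Put `f⁰ = □{f(x̲), f(x̄)}`, `s = f[x̲, x̄]`,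
  `d̲ = c̲·rad(x) + |s/2|`, `d̄ = c̄·rad(x) − |s/2|`, and define `f_p(x)` by
  (10a) `inf f_p(x) := f̲⁰` if `d̄ ≤ 0`, `f̲⁰ − d̄²/c̄` otherwise;
  (10b) `sup f_p(x) := f̄⁰` if `d̲ ≥ 0`, `f̄⁰ − d̲²/c̲` otherwise. Then
  (11) `f*(x) ⊆ f_p(x) ⊆ f*(x) + 2·rad(c)·rad(x)²·[−1, 1]`.
* Remarks after Theorem 2.4.2: (ii) the pointwise enclosure (12)
  `f(x̃) ∈ [p(x̃, c̄), p(x̃, c̲)]`; (iii) under (13) `2|c|rad(x) ≤ |f[x̲, x̄]|` the form is exact,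
  `f_p(x) = f⁰ = f*(x)`; (iv) for `f ∈ C²`, (9) holds with `c = ½ f''(x)` and (14)
  `0 ≤ rad f_p(x) − rad f*(x) ≤ 2·rad(c)·rad(x)²` (cubic approximation order).

## Rendering

Intervals are endpoint pairs of reals (`xl ≤ xu`, `cl ≤ cu`); the range `f*(x)` is the image
`f '' Icc xl xu`, read through its hull `[rangeInf, rangeSup]` (`sInf`/`sSup`) wherever the book
takes `q` or `rad` of a range, and through explicit points of `x` otherwise (the inclusions (4),
(11), (12) are stated pointwise, the reverse inclusions of (5), (11) by exhibiting points of `x`).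
`2·rad(c)` is written `cu - cl`. The hypothesis (9) uses the second divided difference
`Literature.Analysis.Calculus.secondDividedDiff f x̲ x̃ x̄ = f[x̲, x̃, x̄] = f[x̲, x̄, x̃]` of
`Literature/Analysis/Calculus/SecondDividedDifference.lean`, whose generalised mean value theorem
`exists_secondDividedDiff_eq` gives Remark (iv). In Theorem 2.4.1 (5) the magnitude `|e*(x)|`
enters as any bound `E` with `|e(x̃)| ≤ E` on `x` (equivalent: take `E = |e*(x)|`), and the
attainment of `sup p*(x, c̃)` used in the printed proof is supplied by continuity of `p` and `e`
on the compact interval (extreme value theorem); (4), (6) and (12) need no continuity, and — as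
the book stresses in Remark (vi) — `f` itself is arbitrary throughout. Theorem 2.4.2 is proved
from the closed form directly: the lower parabola `p(x̃, c̄)` is bounded below on `x` by (10a)
and attains (10a) at an endpoint (`d̄ ≤ 0`) or at its vertex `x̌ − s/(2c̄) ∈ x` (`d̄ > 0`);
(10b) is (10a) for `−f` and `−c`.

Honest differences. The thin case of Theorem 2.4.2 (`f_p(x) := f(x)`) is the closed form
itself (`pbvLo_thin`, `pbvHi_thin`); the main statements assume `x̲ < x̄`, where (9) is not
vacuous. Rounding (Remark (i)), Fig. 2.2, the numerical example of Remark (v) and the Taylor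
variant of Remark (vii) are not formalised; of Remark (v) only the algebraic core (13) ⇒
exactness is (Remark (iii)).
-/

set_option autoImplicit false

noncomputable section

open Set Literature.Analysis.Calculus

namespace Literature.Analysis.ValidatedNumerics.InterpolationForm

variable {f p e : ℝ → ℝ} {xl xu cl cu : ℝ}

/-! ## The general interpolation form: Theorem 2.4.1 -/

/-- Hypothesis **(1)** of §2.4: `f(x̃) = p(x̃) + c̃ e(x̃)` with some `c̃ ∈ [c̲, c̄]`, for every
`x̃ ∈ x = [x̲, x̄]`. [cite: Neumaier1991, §2.4 (1)] -/
def HasDecomp (f p e : ℝ → ℝ) (xl xu cl cu : ℝ) : Prop :=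
  ∀ ξ ∈ Icc xl xu, ∃ c ∈ Icc cl cu, f ξ = p ξ + c * e ξ

/-- **(3)** `p(x̃, c̃) := p(x̃) + c̃ e(x̃)`. [cite: Neumaier1991, §2.4 (3)] -/
def pc (p e : ℝ → ℝ) (c ξ : ℝ) : ℝ := p ξ + c * e ξ

/-- Lower endpoint of the interpolation form **(2)** `f_p(x) = □(p*(x, c̲) ∪ p*(x, c̄))`.
[cite: Neumaier1991, §2.4 (2)] -/
def ipLo (p e : ℝ → ℝ) (xl xu cl cu : ℝ) : ℝ :=
  sInf (pc p e cl '' Icc xl xu ∪ pc p e cu '' Icc xl xu)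

/-- Upper endpoint of the interpolation form **(2)** `f_p(x) = □(p*(x, c̲) ∪ p*(x, c̄))`.
[cite: Neumaier1991, §2.4 (2)] -/
def ipHi (p e : ℝ → ℝ) (xl xu cl cu : ℝ) : ℝ :=
  sSup (pc p e cl '' Icc xl xu ∪ pc p e cu '' Icc xl xu)

/-- `inf f*(x)`, the lower endpoint of the hull of the range `f*(x) = {f(x̃) | x̃ ∈ x}`.
[cite: Neumaier1991, §2.3 (1) (the range f*(x)), §2.4 Thm 2.4.1 (4)] -/
def rangeInf (f : ℝ → ℝ) (xl xu : ℝ) : ℝ := sInf (f '' Icc xl xu)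

/-- `sup f*(x)`, the upper endpoint of the hull of the range `f*(x)`.
[cite: Neumaier1991, §2.3 (1) (the range f*(x)), §2.4 Thm 2.4.1 (4)] -/
def rangeSup (f : ℝ → ℝ) (xl xu : ℝ) : ℝ := sSup (f '' Icc xl xu)

/-- `p(x̃, c̃) − p(x̃, c̃') = (c̃ − c̃') e(x̃)` — the step "`= (c* − c̃)e(x*)`" in the proof of (5).
[cite: Neumaier1991, Thm 2.4.1, proof of (5)] -/
theorem pc_sub_pc (p e : ℝ → ℝ) (c c' ξ : ℝ) : pc p e c ξ - pc p e c' ξ = (c - c') * e ξ := by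
  unfold pc; ring

/-- `p(x̃, ·)` is linear, hence on `[c̲, c̄]` it is bounded below by its smaller endpoint value.
[cite: Neumaier1991, Thm 2.4.1, proof of (4) (p(x̃, ·) takes its extrema in an endpoint of c)] -/
theorem min_pc_le {c : ℝ} (hc : c ∈ Icc cl cu) (ξ : ℝ) :
    min (pc p e cl ξ) (pc p e cu ξ) ≤ pc p e c ξ := by
  unfold pc
  rcases le_total 0 (e ξ) with he | he
  · have h : cl * e ξ ≤ c * e ξ := mul_le_mul_of_nonneg_right hc.1 he
    exact le_trans (min_le_left _ _) (by linarith)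
  · have h : cu * e ξ ≤ c * e ξ := mul_le_mul_of_nonpos_right hc.2 he
    exact le_trans (min_le_right _ _) (by linarith)

/-- `p(x̃, ·)` is linear, hence on `[c̲, c̄]` it is bounded above by its larger endpoint value.
[cite: Neumaier1991, Thm 2.4.1, proof of (4) (p(x̃, ·) takes its maximum in an endpoint of c)] -/
theorem pc_le_max {c : ℝ} (hc : c ∈ Icc cl cu) (ξ : ℝ) :
    pc p e c ξ ≤ max (pc p e cl ξ) (pc p e cu ξ) := by
  unfold pc
  rcases le_total 0 (e ξ) with he | he
  · have h : c * e ξ ≤ cu * e ξ := mul_le_mul_of_nonneg_right hc.2 he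
    exact le_trans (by linarith) (le_max_right _ _)
  · have h : c * e ξ ≤ cl * e ξ := mul_le_mul_of_nonpos_right hc.1 he
    exact le_trans (by linarith) (le_max_left _ _)

/-- Under (1), `f(x̃)` lies between `p(x̃, c̲)` and `p(x̃, c̄)` (pointwise core of (4)).
[cite: Neumaier1991, Thm 2.4.1 (4) and its proof] -/
theorem min_pc_le_f (hd : HasDecomp f p e xl xu cl cu) {ξ : ℝ} (hξ : ξ ∈ Icc xl xu) :
    min (pc p e cl ξ) (pc p e cu ξ) ≤ f ξ ∧ f ξ ≤ max (pc p e cl ξ) (pc p e cu ξ) := by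
  obtain ⟨c, hc, hfc⟩ := hd ξ hξ
  have h : f ξ = pc p e c ξ := hfc
  rw [h]
  exact ⟨min_pc_le hc ξ, pc_le_max hc ξ⟩

/-- **Theorem 2.4.1 (4)** with arbitrary enclosures of the two ranges: if
`p*(x, c̲) ⊆ [P̲, P̄]` and `p*(x, c̄) ⊆ [Q̲, Q̄]` then `f*(x) ⊆ □([P̲, P̄] ∪ [Q̲, Q̄])`.
[cite: Neumaier1991, Thm 2.4.1 (4)] -/
theorem enclosure_of_bounds (hd : HasDecomp f p e xl xu cl cu) {Pl Pu Ql Qu : ℝ}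
    (hP : ∀ ξ ∈ Icc xl xu, Pl ≤ pc p e cl ξ ∧ pc p e cl ξ ≤ Pu)
    (hQ : ∀ ξ ∈ Icc xl xu, Ql ≤ pc p e cu ξ ∧ pc p e cu ξ ≤ Qu) {ξ : ℝ} (hξ : ξ ∈ Icc xl xu) :
    min Pl Ql ≤ f ξ ∧ f ξ ≤ max Pu Qu := by
  have h := min_pc_le_f hd hξ
  have h1 := hP ξ hξ
  have h2 := hQ ξ hξ
  constructor
  · exact le_trans (min_le_min h1.1 h2.1) h.1
  · exact le_trans h.2 (max_le_max h1.2 h2.2)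

/-- If `p` and `e` are continuous on `x`, the two ranges `p*(x, c̲)`, `p*(x, c̄)` are bounded
(compactness of `x`), so the hull (2) is a genuine interval.
[cite: Neumaier1991, §2.4 (2) (f_p(x) is an interval)] -/
theorem bdd_of_continuousOn (hp : ContinuousOn p (Icc xl xu)) (he : ContinuousOn e (Icc xl xu)) :
    BddBelow (pc p e cl '' Icc xl xu ∪ pc p e cu '' Icc xl xu) ∧
      BddAbove (pc p e cl '' Icc xl xu ∪ pc p e cu '' Icc xl xu) := by
  have hc : ∀ c : ℝ, ContinuousOn (pc p e c) (Icc xl xu) := fun c =>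
    hp.add (continuousOn_const.mul he)
  constructor
  · exact (isCompact_Icc.bddBelow_image (hc cl)).union (isCompact_Icc.bddBelow_image (hc cu))
  · exact (isCompact_Icc.bddAbove_image (hc cl)).union (isCompact_Icc.bddAbove_image (hc cu))

/-- **Theorem 2.4.1 (4)**, lower half: `inf f_p(x) ≤ f(x̃)` for `x̃ ∈ x`.
[cite: Neumaier1991, Thm 2.4.1 (4)] -/
theorem ipLo_le (hd : HasDecomp f p e xl xu cl cu)
    (hb : BddBelow (pc p e cl '' Icc xl xu ∪ pc p e cu '' Icc xl xu)) {ξ : ℝ} (hξ : ξ ∈ Icc xl xu) :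
    ipLo p e xl xu cl cu ≤ f ξ := by
  have h1 : ipLo p e xl xu cl cu ≤ pc p e cl ξ := csInf_le hb (Or.inl ⟨ξ, hξ, rfl⟩)
  have h2 : ipLo p e xl xu cl cu ≤ pc p e cu ξ := csInf_le hb (Or.inr ⟨ξ, hξ, rfl⟩)
  exact le_trans (le_min h1 h2) (min_pc_le_f hd hξ).1

/-- **Theorem 2.4.1 (4)**, upper half: `f(x̃) ≤ sup f_p(x)` for `x̃ ∈ x`.
[cite: Neumaier1991, Thm 2.4.1 (4)] -/
theorem le_ipHi (hd : HasDecomp f p e xl xu cl cu)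
    (hb : BddAbove (pc p e cl '' Icc xl xu ∪ pc p e cu '' Icc xl xu)) {ξ : ℝ} (hξ : ξ ∈ Icc xl xu) :
    f ξ ≤ ipHi p e xl xu cl cu := by
  have h1 : pc p e cl ξ ≤ ipHi p e xl xu cl cu := le_csSup hb (Or.inl ⟨ξ, hξ, rfl⟩)
  have h2 : pc p e cu ξ ≤ ipHi p e xl xu cl cu := le_csSup hb (Or.inr ⟨ξ, hξ, rfl⟩)
  exact le_trans (min_pc_le_f hd hξ).2 (max_le h1 h2)

/-- **Theorem 2.4.1 (4)**: `f*(x) ⊆ f_p(x)`. [cite: Neumaier1991, Thm 2.4.1 (4)] -/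
theorem range_subset_ip (hd : HasDecomp f p e xl xu cl cu)
    (hb : BddBelow (pc p e cl '' Icc xl xu ∪ pc p e cu '' Icc xl xu))
    (hb' : BddAbove (pc p e cl '' Icc xl xu ∪ pc p e cu '' Icc xl xu)) :
    f '' Icc xl xu ⊆ Icc (ipLo p e xl xu cl cu) (ipHi p e xl xu cl cu) := by
  rintro _ ⟨ξ, hξ, rfl⟩
  exact ⟨ipLo_le hd hb hξ, le_ipHi hd hb' hξ⟩

/-- Under (1) on a nonempty `x`, the coefficient interval is a genuine interval: `c̲ ≤ c̄`.
[cite: Neumaier1991, §2.4 (1) (c ∈ 𝕀ℝ)] -/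
theorem cl_le_cu (hx : xl ≤ xu) (hd : HasDecomp f p e xl xu cl cu) : cl ≤ cu := by
  obtain ⟨c, hc, -⟩ := hd xl ⟨le_rfl, hx⟩
  exact le_trans hc.1 hc.2

/-- The estimate `(c* − c̃)e(x*) ≤ 2·rad(c)|e*(x)|` of the proof of (5): for `c*, c̃ ∈ c` and
`|e(x̃)| ≤ E`, `|(c* − c̃) e(x̃)| ≤ (c̄ − c̲) E`. [cite: Neumaier1991, Thm 2.4.1, proof of (5)] -/
theorem abs_sub_mul_le {a b t E : ℝ} (ha : a ∈ Icc cl cu) (hb : b ∈ Icc cl cu) (ht : |t| ≤ E) :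
    |(a - b) * t| ≤ (cu - cl) * E := by
  rw [abs_mul]
  have h1 : |a - b| ≤ cu - cl := by
    rw [abs_sub_le_iff]; constructor <;> linarith [ha.1, ha.2, hb.1, hb.2]
  exact mul_le_mul h1 ht (abs_nonneg _) (by linarith [ha.1, ha.2])

/-- A continuous `p(·, c̃)` attains `sup p*(x, c̃)` at some `x* ∈ x` (the point `x*` of the proof
of (5)). [cite: Neumaier1991, Thm 2.4.1, proof of (5) (sup f_p(x) = p(x*, c*) for some x* ∈ x)] -/
theorem exists_sSup_eq (hx : xl ≤ xu) (hp : ContinuousOn p (Icc xl xu))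
    (he : ContinuousOn e (Icc xl xu)) (c : ℝ) :
    ∃ ξ ∈ Icc xl xu, IsGreatest (pc p e c '' Icc xl xu) (pc p e c ξ) := by
  have hc : ContinuousOn (pc p e c) (Icc xl xu) := hp.add (continuousOn_const.mul he)
  obtain ⟨ξ, hξ, hmax⟩ :=
    isCompact_Icc.exists_isMaxOn (nonempty_Icc.2 hx) hc
  refine ⟨ξ, hξ, ⟨ξ, hξ, rfl⟩, ?_⟩
  rintro _ ⟨ζ, hζ, rfl⟩
  exact hmax hζ

/-- A continuous `p(·, c̃)` attains `inf p*(x, c̃)` at some point of `x`.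
[cite: Neumaier1991, Thm 2.4.1, proof of (5) (the symmetric argument for the infimum)] -/
theorem exists_sInf_eq (hx : xl ≤ xu) (hp : ContinuousOn p (Icc xl xu))
    (he : ContinuousOn e (Icc xl xu)) (c : ℝ) :
    ∃ ξ ∈ Icc xl xu, IsLeast (pc p e c '' Icc xl xu) (pc p e c ξ) := by
  have hc : ContinuousOn (pc p e c) (Icc xl xu) := hp.add (continuousOn_const.mul he)
  obtain ⟨ξ, hξ, hmin⟩ :=
    isCompact_Icc.exists_isMinOn (nonempty_Icc.2 hx) hc
  refine ⟨ξ, hξ, ⟨ξ, hξ, rfl⟩, ?_⟩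
  rintro _ ⟨ζ, hζ, rfl⟩
  exact hmin hζ

/-- **Theorem 2.4.1 (5)**, sup side, pointwise: some `x* ∈ x` has
`f(x*) ≥ sup f_p(x) − 2·rad(c)|e*(x)|`. [cite: Neumaier1991, Thm 2.4.1 (5) and its proof] -/
theorem exists_ge_ipHi_sub (hx : xl ≤ xu) (hd : HasDecomp f p e xl xu cl cu)
    (hp : ContinuousOn p (Icc xl xu)) (he : ContinuousOn e (Icc xl xu)) {E : ℝ}
    (hE : ∀ ξ ∈ Icc xl xu, |e ξ| ≤ E) :
    ∃ ξ ∈ Icc xl xu, ipHi p e xl xu cl cu - (cu - cl) * E ≤ f ξ := by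
  have hcc : cl ≤ cu := cl_le_cu hx hd
  obtain ⟨ξ1, hξ1, hg1⟩ := exists_sSup_eq hx hp he cl
  obtain ⟨ξ2, hξ2, hg2⟩ := exists_sSup_eq hx hp he cu
  have hA : sSup (pc p e cl '' Icc xl xu) = pc p e cl ξ1 := hg1.csSup_eq
  have hB : sSup (pc p e cu '' Icc xl xu) = pc p e cu ξ2 := hg2.csSup_eq
  have hU : ipHi p e xl xu cl cu = max (pc p e cl ξ1) (pc p e cu ξ2) := by
    unfold ipHi
    rw [csSup_union hg1.bddAbove ⟨_, hg1.1⟩ hg2.bddAbove ⟨_, hg2.1⟩, hA, hB]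
  rcases le_total (pc p e cl ξ1) (pc p e cu ξ2) with h12 | h12
  · -- the maximum is attained by `p(·, c̄)` at `ξ2`
    obtain ⟨c, hc, hfc⟩ := hd ξ2 hξ2
    refine ⟨ξ2, hξ2, ?_⟩
    have hdiff : pc p e cu ξ2 - f ξ2 = (cu - c) * e ξ2 := by rw [hfc]; unfold pc; ring
    have hle : |(cu - c) * e ξ2| ≤ (cu - cl) * E :=
      abs_sub_mul_le ⟨hcc, le_rfl⟩ hc (hE ξ2 hξ2)
    rw [hU, max_eq_right h12]
    linarith [le_abs_self ((cu - c) * e ξ2)]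
  · obtain ⟨c, hc, hfc⟩ := hd ξ1 hξ1
    refine ⟨ξ1, hξ1, ?_⟩
    have hdiff : pc p e cl ξ1 - f ξ1 = (cl - c) * e ξ1 := by rw [hfc]; unfold pc; ring
    have hle : |(cl - c) * e ξ1| ≤ (cu - cl) * E :=
      abs_sub_mul_le ⟨le_rfl, hcc⟩ hc (hE ξ1 hξ1)
    rw [hU, max_eq_left h12]
    linarith [le_abs_self ((cl - c) * e ξ1)]

/-- **Theorem 2.4.1 (5)**, inf side, pointwise: some `x_* ∈ x` has
`f(x_*) ≤ inf f_p(x) + 2·rad(c)|e*(x)|`. [cite: Neumaier1991, Thm 2.4.1 (5) and its proof] -/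
theorem exists_le_ipLo_add (hx : xl ≤ xu) (hd : HasDecomp f p e xl xu cl cu)
    (hp : ContinuousOn p (Icc xl xu)) (he : ContinuousOn e (Icc xl xu)) {E : ℝ}
    (hE : ∀ ξ ∈ Icc xl xu, |e ξ| ≤ E) :
    ∃ ξ ∈ Icc xl xu, f ξ ≤ ipLo p e xl xu cl cu + (cu - cl) * E := by
  have hcc : cl ≤ cu := cl_le_cu hx hd
  obtain ⟨ξ1, hξ1, hg1⟩ := exists_sInf_eq hx hp he cl
  obtain ⟨ξ2, hξ2, hg2⟩ := exists_sInf_eq hx hp he cu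
  have hA : sInf (pc p e cl '' Icc xl xu) = pc p e cl ξ1 := hg1.csInf_eq
  have hB : sInf (pc p e cu '' Icc xl xu) = pc p e cu ξ2 := hg2.csInf_eq
  have hU : ipLo p e xl xu cl cu = min (pc p e cl ξ1) (pc p e cu ξ2) := by
    unfold ipLo
    rw [csInf_union hg1.bddBelow ⟨_, hg1.1⟩ hg2.bddBelow ⟨_, hg2.1⟩, hA, hB]
  rcases le_total (pc p e cl ξ1) (pc p e cu ξ2) with h12 | h12
  · obtain ⟨c, hc, hfc⟩ := hd ξ1 hξ1
    refine ⟨ξ1, hξ1, ?_⟩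
    have hdiff : pc p e cl ξ1 - f ξ1 = (cl - c) * e ξ1 := by rw [hfc]; unfold pc; ring
    have hle : |(cl - c) * e ξ1| ≤ (cu - cl) * E :=
      abs_sub_mul_le ⟨le_rfl, hcc⟩ hc (hE ξ1 hξ1)
    rw [hU, min_eq_left h12]
    linarith [neg_abs_le ((cl - c) * e ξ1)]
  · obtain ⟨c, hc, hfc⟩ := hd ξ2 hξ2
    refine ⟨ξ2, hξ2, ?_⟩
    have hdiff : pc p e cu ξ2 - f ξ2 = (cu - c) * e ξ2 := by rw [hfc]; unfold pc; ring
    have hle : |(cu - c) * e ξ2| ≤ (cu - cl) * E :=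
      abs_sub_mul_le ⟨hcc, le_rfl⟩ hc (hE ξ2 hξ2)
    rw [hU, min_eq_right h12]
    linarith [neg_abs_le ((cu - c) * e ξ2)]

/-- Under (1) with continuous `p`, `e`, the range `f*(x)` is bounded (it lies in `f_p(x)`), so
its hull `[inf f*, sup f*]` is meaningful. [cite: Neumaier1991, Thm 2.4.1 (4)] -/
theorem bdd_range (hd : HasDecomp f p e xl xu cl cu) (hp : ContinuousOn p (Icc xl xu))
    (he : ContinuousOn e (Icc xl xu)) :
    BddBelow (f '' Icc xl xu) ∧ BddAbove (f '' Icc xl xu) := by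
  obtain ⟨hb, hb'⟩ := bdd_of_continuousOn (cl := cl) (cu := cu) hp he
  exact ⟨⟨_, fun _ hy => (range_subset_ip hd hb hb' hy).1⟩,
    ⟨_, fun _ hy => (range_subset_ip hd hb hb' hy).2⟩⟩

/-- **Theorem 2.4.1 (5)**: `q(f_p(x), f*(x)) ≤ 2·rad(c)|e*(x)|`, with `q` the Hausdorff distance
`q(a, b) = max(|a̲ − b̲|, |ā − b̄|)` of Prop 1.7.1 (2), for continuous `p`, `e` and any bound
`|e| ≤ E` on `x`. [cite: Neumaier1991, Thm 2.4.1 (5); Prop 1.7.1 (2)] -/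
theorem dist_ip_range_le (hx : xl ≤ xu) (hd : HasDecomp f p e xl xu cl cu)
    (hp : ContinuousOn p (Icc xl xu)) (he : ContinuousOn e (Icc xl xu)) {E : ℝ}
    (hE : ∀ ξ ∈ Icc xl xu, |e ξ| ≤ E) :
    max |ipLo p e xl xu cl cu - rangeInf f xl xu| |ipHi p e xl xu cl cu - rangeSup f xl xu|
      ≤ (cu - cl) * E := by
  obtain ⟨hb, hb'⟩ := bdd_of_continuousOn (cl := cl) (cu := cu) hp he
  obtain ⟨hr, hr'⟩ := bdd_range hd hp he
  have hne : (f '' Icc xl xu).Nonempty := ⟨f xl, xl, ⟨le_rfl, hx⟩, rfl⟩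
  have h1 : ipLo p e xl xu cl cu ≤ rangeInf f xl xu :=
    le_csInf hne (by rintro _ ⟨ξ, hξ, rfl⟩; exact ipLo_le hd hb hξ)
  have h2 : rangeSup f xl xu ≤ ipHi p e xl xu cl cu :=
    csSup_le hne (by rintro _ ⟨ξ, hξ, rfl⟩; exact le_ipHi hd hb' hξ)
  obtain ⟨ξ1, hξ1, hf1⟩ := exists_le_ipLo_add hx hd hp he hE
  obtain ⟨ξ2, hξ2, hf2⟩ := exists_ge_ipHi_sub hx hd hp he hE
  have h3 : rangeInf f xl xu ≤ f ξ1 := csInf_le hr ⟨ξ1, hξ1, rfl⟩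
  have h4 : f ξ2 ≤ rangeSup f xl xu := le_csSup hr' ⟨ξ2, hξ2, rfl⟩
  refine max_le ?_ ?_
  · rw [abs_sub_comm, abs_of_nonneg (by linarith)]; linarith
  · rw [abs_of_nonneg (by linarith)]; linarith

/-- Remark (ii) **(12)** / the case `e*(x) ≤ 0` of Theorem 2.4.1: pointwise
`p(x̃, c̄) ≤ f(x̃) ≤ p(x̃, c̲)` for `x̃ ∈ x`. [cite: Neumaier1991, §2.4 (12); Thm 2.4.1, proof of (6)] -/
theorem sandwich_of_nonpos (hd : HasDecomp f p e xl xu cl cu) (he0 : ∀ ξ ∈ Icc xl xu, e ξ ≤ 0)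
    {ξ : ℝ} (hξ : ξ ∈ Icc xl xu) : pc p e cu ξ ≤ f ξ ∧ f ξ ≤ pc p e cl ξ := by
  obtain ⟨c, hc, hfc⟩ := hd ξ hξ
  have h := he0 ξ hξ
  have h1 : cu * e ξ ≤ c * e ξ := mul_le_mul_of_nonpos_right hc.2 h
  have h2 : c * e ξ ≤ cl * e ξ := mul_le_mul_of_nonpos_right hc.1 h
  unfold pc
  constructor <;> linarith

/-- **Theorem 2.4.1 (6)**, lower endpoint: if `e*(x) ≤ 0` then `inf f_p(x) = inf p*(x, c̄)`.
[cite: Neumaier1991, Thm 2.4.1 (6)] -/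
theorem ipLo_eq_of_nonpos (hx : xl ≤ xu) (hc : cl ≤ cu) (he0 : ∀ ξ ∈ Icc xl xu, e ξ ≤ 0)
    (hA : BddBelow (pc p e cl '' Icc xl xu)) (hB : BddBelow (pc p e cu '' Icc xl xu)) :
    ipLo p e xl xu cl cu = sInf (pc p e cu '' Icc xl xu) := by
  have hneA : (pc p e cl '' Icc xl xu).Nonempty := ⟨_, xl, ⟨le_rfl, hx⟩, rfl⟩
  have hneB : (pc p e cu '' Icc xl xu).Nonempty := ⟨_, xl, ⟨le_rfl, hx⟩, rfl⟩
  have hle : sInf (pc p e cu '' Icc xl xu) ≤ sInf (pc p e cl '' Icc xl xu) := by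
    refine le_csInf hneA ?_
    rintro _ ⟨ξ, hξ, rfl⟩
    have h1 : sInf (pc p e cu '' Icc xl xu) ≤ pc p e cu ξ := csInf_le hB ⟨ξ, hξ, rfl⟩
    have h2 : cu * e ξ ≤ cl * e ξ := mul_le_mul_of_nonpos_right hc (he0 ξ hξ)
    have h3 : pc p e cu ξ ≤ pc p e cl ξ := by unfold pc; linarith
    exact le_trans h1 h3
  unfold ipLo
  rw [csInf_union hA hneA hB hneB]
  exact min_eq_right hle

/-- **Theorem 2.4.1 (6)**, upper endpoint: if `e*(x) ≤ 0` then `sup f_p(x) = sup p*(x, c̲)`.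
[cite: Neumaier1991, Thm 2.4.1 (6)] -/
theorem ipHi_eq_of_nonpos (hx : xl ≤ xu) (hc : cl ≤ cu) (he0 : ∀ ξ ∈ Icc xl xu, e ξ ≤ 0)
    (hA : BddAbove (pc p e cl '' Icc xl xu)) (hB : BddAbove (pc p e cu '' Icc xl xu)) :
    ipHi p e xl xu cl cu = sSup (pc p e cl '' Icc xl xu) := by
  have hneA : (pc p e cl '' Icc xl xu).Nonempty := ⟨_, xl, ⟨le_rfl, hx⟩, rfl⟩
  have hneB : (pc p e cu '' Icc xl xu).Nonempty := ⟨_, xl, ⟨le_rfl, hx⟩, rfl⟩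
  have hle : sSup (pc p e cu '' Icc xl xu) ≤ sSup (pc p e cl '' Icc xl xu) := by
    refine csSup_le hneB ?_
    rintro _ ⟨ξ, hξ, rfl⟩
    have h1 : pc p e cl ξ ≤ sSup (pc p e cl '' Icc xl xu) := le_csSup hA ⟨ξ, hξ, rfl⟩
    have h2 : cu * e ξ ≤ cl * e ξ := mul_le_mul_of_nonpos_right hc (he0 ξ hξ)
    have h3 : pc p e cu ξ ≤ pc p e cl ξ := by unfold pc; linarith
    exact le_trans h3 h1
  unfold ipHi
  rw [csSup_union hA hneA hB hneB]
  exact max_eq_left hle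

/-! ## The parabolic boundary value form: Theorem 2.4.2 -/

/-- `rad(x) = (x̄ − x̲)/2`. [cite: Neumaier1991, §1.2 (radius); Thm 2.4.2 (d̲, d̄)] -/
def rad (xl xu : ℝ) : ℝ := (xu - xl) / 2

/-- `x̌ = (x̲ + x̄)/2`. [cite: Neumaier1991, §1.2 (midpoint x̌); Thm 2.4.2, proof (the vertex x* = x̌ − s/(2c̄))] -/
def mid (xl xu : ℝ) : ℝ := (xl + xu) / 2

/-- The linear interpolant at the endpoints, `p(ξ) := f(x̲) + f[x̲, x̄](ξ − x̲)`
(`f[x̲, x̄] = slope f x̲ x̄`). [cite: Neumaier1991, Thm 2.4.2, proof (p(ξ) := f(x̲) + f[x̲, x̄](ξ − x̲))] -/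
def lin (f : ℝ → ℝ) (xl xu ξ : ℝ) : ℝ := f xl + slope f xl xu * (ξ - xl)

/-- The error function `e(ξ) := (ξ − x̲)(ξ − x̄)`. [cite: Neumaier1991, Thm 2.4.2, proof (e(ξ) := (ξ − x̲)(ξ − x̄))] -/
def err (xl xu ξ : ℝ) : ℝ := (ξ - xl) * (ξ - xu)

/-- `f̲⁰ = min(f(x̲), f(x̄))`, the lower endpoint of `f⁰ = □{f(x̲), f(x̄)}`.
[cite: Neumaier1991, Thm 2.4.2 (f⁰ = □{f(x̲), f(x̄)})] -/
def f0lo (f : ℝ → ℝ) (xl xu : ℝ) : ℝ := min (f xl) (f xu)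

/-- `f̄⁰ = max(f(x̲), f(x̄))`, the upper endpoint of `f⁰ = □{f(x̲), f(x̄)}`.
[cite: Neumaier1991, Thm 2.4.2 (f⁰ = □{f(x̲), f(x̄)})] -/
def f0hi (f : ℝ → ℝ) (xl xu : ℝ) : ℝ := max (f xl) (f xu)

/-- `d̲ = c̲·rad(x) + |s/2|`, `s = f[x̲, x̄]`. [cite: Neumaier1991, Thm 2.4.2 (d̲)] -/
def dlo (f : ℝ → ℝ) (xl xu cl : ℝ) : ℝ := cl * rad xl xu + |slope f xl xu / 2|

/-- `d̄ = c̄·rad(x) − |s/2|`, `s = f[x̲, x̄]`. [cite: Neumaier1991, Thm 2.4.2 (d̄)] -/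
def dhi (f : ℝ → ℝ) (xl xu cu : ℝ) : ℝ := cu * rad xl xu - |slope f xl xu / 2|

/-- **(10a)** `inf f_p(x) := f̲⁰` if `d̄ ≤ 0`, `f̲⁰ − d̄²/c̄` otherwise.
[cite: Neumaier1991, Thm 2.4.2 (10a)] -/
def pbvLo (f : ℝ → ℝ) (xl xu cu : ℝ) : ℝ :=
  if dhi f xl xu cu ≤ 0 then f0lo f xl xu else f0lo f xl xu - dhi f xl xu cu ^ 2 / cu

/-- **(10b)** `sup f_p(x) := f̄⁰` if `d̲ ≥ 0`, `f̄⁰ − d̲²/c̲` otherwise.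
[cite: Neumaier1991, Thm 2.4.2 (10b)] -/
def pbvHi (f : ℝ → ℝ) (xl xu cl : ℝ) : ℝ :=
  if 0 ≤ dlo f xl xu cl then f0hi f xl xu else f0hi f xl xu - dlo f xl xu cl ^ 2 / cl

/-- Hypothesis **(9)**: `f[x̲, x̄, x̃] ∈ c` for all `x̃ ∈ int(x)` (the second divided difference,
symmetric in its arguments, is written `f[x̲, x̃, x̄] = secondDividedDiff f x̲ x̃ x̄`).
[cite: Neumaier1991, Thm 2.4.2 (9)] -/
def HasSecondDD (f : ℝ → ℝ) (xl xu cl cu : ℝ) : Prop :=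
  ∀ ξ ∈ Ioo xl xu, secondDividedDiff f xl ξ xu ∈ Icc cl cu

/-- The thin case `f_p(x) := f(x)`: for `x̲ = x̄` the closed form (10a) returns `f(x̲)`.
[cite: Neumaier1991, Thm 2.4.2 (f_p(x) = f(x) if x is thin)] -/
theorem pbvLo_thin (f : ℝ → ℝ) (a cu : ℝ) : pbvLo f a a cu = f a := by
  have h : dhi f a a cu ≤ 0 := by
    unfold dhi rad; have := abs_nonneg (slope f a a / 2); nlinarith
  unfold pbvLo; rw [if_pos h]; unfold f0lo; exact min_self _

/-- The thin case `f_p(x) := f(x)`: for `x̲ = x̄` the closed form (10b) returns `f(x̲)`.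
[cite: Neumaier1991, Thm 2.4.2 (f_p(x) = f(x) if x is thin)] -/
theorem pbvHi_thin (f : ℝ → ℝ) (a cl : ℝ) : pbvHi f a a cl = f a := by
  have h : 0 ≤ dlo f a a cl := by
    unfold dlo rad; have := abs_nonneg (slope f a a / 2); nlinarith
  unfold pbvHi; rw [if_pos h]; unfold f0hi; exact max_self _

/-- Newton's interpolation formula with the nodes `x̲, x̄`:
`f(ξ) = f(x̲) + f[x̲, x̄](ξ − x̲) + f[x̲, x̄, ξ](ξ − x̲)(ξ − x̄)` for `ξ ∉ {x̲, x̄}`.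
[cite: Neumaier1991, §2.4 (Newton's error formula, k = 1); Thm 2.4.2, proof ((9) implies (1))] -/
theorem newton_two_point (f : ℝ → ℝ) {xl xu ξ : ℝ} (hx : xl ≠ xu) (hl : ξ ≠ xl) (hu : ξ ≠ xu) :
    f ξ = lin f xl xu ξ + secondDividedDiff f xl ξ xu * err xl xu ξ := by
  have h1 : ξ - xl ≠ 0 := sub_ne_zero.2 hl
  have h2 : ξ - xu ≠ 0 := sub_ne_zero.2 hu
  have h3 : xu - xl ≠ 0 := sub_ne_zero.2 (Ne.symm hx)
  have h4 : xl - xu ≠ 0 := sub_ne_zero.2 hx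
  unfold lin err secondDividedDiff
  simp only [slope_def_field]
  field_simp
  ring

/-- `p(x̄) = f(x̄)`: the linear interpolant matches `f` at the right endpoint (at the left one by
definition). [cite: Neumaier1991, Thm 2.4.2, proof (p interpolates f at x̲, x̄)] -/
theorem lin_right (f : ℝ → ℝ) (xl xu : ℝ) : lin f xl xu xu = f xu := by
  unfold lin
  rcases eq_or_ne xl xu with h | h
  · subst h; simp
  · have h3 : xu - xl ≠ 0 := sub_ne_zero.2 (Ne.symm h)
    rw [slope_def_field]; field_simp; ring

/-- `p(x̲) = f(x̲)`. [cite: Neumaier1991, Thm 2.4.2, proof (p interpolates f at x̲, x̄)] -/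
theorem lin_left (f : ℝ → ℝ) (xl xu : ℝ) : lin f xl xu xl = f xl := by
  unfold lin; ring

/-- `e(ξ) = (ξ − x̌)² − rad(x)²`; in particular `e ≤ 0` on `x` and `|e*(x)| = rad(x)²`.
[cite: Neumaier1991, Thm 2.4.2, proof (e*(x) = [−rad(x)², 0])] -/
theorem err_eq (xl xu ξ : ℝ) : err xl xu ξ = (ξ - mid xl xu) ^ 2 - rad xl xu ^ 2 := by
  unfold err mid rad; ring

/-- `e*(x) ≤ 0`: `e(ξ) ≤ 0` for `ξ ∈ x`. [cite: Neumaier1991, Thm 2.4.2, proof (e*(x) = [−rad(x)², 0] ≤ 0)] -/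
theorem err_nonpos {xl xu ξ : ℝ} (hξ : ξ ∈ Icc xl xu) : err xl xu ξ ≤ 0 := by
  unfold err; nlinarith [hξ.1, hξ.2]

/-- `|e(ξ)| ≤ rad(x)²` for `ξ ∈ x` (`|e*(x)| = rad(x)²`).
[cite: Neumaier1991, Thm 2.4.2, proof (e*(x) = [−rad(x)², 0])] -/
theorem abs_err_le {xl xu ξ : ℝ} (hξ : ξ ∈ Icc xl xu) : |err xl xu ξ| ≤ rad xl xu ^ 2 := by
  rw [abs_of_nonpos (err_nonpos hξ), err_eq]
  nlinarith [sq_nonneg (ξ - mid xl xu)]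

/-- On a thick interval, (9) forces `c̲ ≤ c̄` (apply it at the midpoint).
[cite: Neumaier1991, Thm 2.4.2 (9) (c ∈ 𝕀ℝ)] -/
theorem cl_le_cu_of_hasSecondDD (hx : xl < xu) (h : HasSecondDD f xl xu cl cu) : cl ≤ cu := by
  have hm : mid xl xu ∈ Ioo xl xu := by unfold mid; constructor <;> linarith
  obtain ⟨h1, h2⟩ := h _ hm
  exact le_trans h1 h2

/-- (9) implies (1) with `p` the linear interpolant and `e(ξ) = (ξ − x̲)(ξ − x̄)`.
[cite: Neumaier1991, Thm 2.4.2, proof ("Then (9) implies (1)")] -/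
theorem hasDecomp_of_hasSecondDD (hx : xl < xu) (h : HasSecondDD f xl xu cl cu) :
    HasDecomp f (lin f xl xu) (err xl xu) xl xu cl cu := by
  intro ξ hξ
  have hm : mid xl xu ∈ Ioo xl xu := by unfold mid; constructor <;> linarith
  rcases eq_or_ne ξ xl with hl | hl
  · refine ⟨_, h _ hm, ?_⟩
    subst hl; rw [lin_left]; unfold err; ring
  rcases eq_or_ne ξ xu with hu | hu
  · refine ⟨_, h _ hm, ?_⟩
    subst hu; rw [lin_right]; unfold err; ring
  have hξ' : ξ ∈ Ioo xl xu := ⟨lt_of_le_of_ne hξ.1 (Ne.symm hl), lt_of_le_of_ne hξ.2 hu⟩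
  exact ⟨_, h ξ hξ', newton_two_point f hx.ne hl hu⟩

/-- The linear interpolant through the midpoint: `p(ξ) = (f(x̲) + f(x̄))/2 + s(ξ − x̌)`.
[cite: Neumaier1991, Thm 2.4.2, proof (p(x*) = ½(f(x̲) + f(x̄)) − s²/(2c̄))] -/
theorem lin_eq_mid (f : ℝ → ℝ) (xl xu ξ : ℝ) :
    lin f xl xu ξ = (f xl + f xu) / 2 + slope f xl xu * (ξ - mid xl xu) := by
  rcases eq_or_ne xl xu with h | h
  · subst h; unfold lin mid; simp
  · have h3 : xu - xl ≠ 0 := sub_ne_zero.2 (Ne.symm h)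
    unfold lin mid; rw [slope_def_field]; field_simp; ring

/-- `f̲⁰ = ½(f(x̲) + f(x̄)) − |s|·rad(x)`. [cite: Neumaier1991, Thm 2.4.2, proof (½(f(x̲) + f(x̄)) − |s|rad(x) = f̲⁰)] -/
theorem f0lo_eq (f : ℝ → ℝ) {xl xu : ℝ} (hx : xl ≤ xu) :
    f0lo f xl xu = (f xl + f xu) / 2 - |slope f xl xu| * rad xl xu := by
  have key : slope f xl xu * rad xl xu = (f xu - f xl) / 2 := by
    rcases eq_or_ne xl xu with h | h
    · subst h; unfold rad; simp
    · have h3 : xu - xl ≠ 0 := sub_ne_zero.2 (Ne.symm h)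
      unfold rad; rw [slope_def_field]; field_simp
  have hr : 0 ≤ rad xl xu := by unfold rad; linarith
  unfold f0lo
  rcases le_total 0 (slope f xl xu) with hs | hs
  · rw [abs_of_nonneg hs]
    have : f xl ≤ f xu := by nlinarith
    rw [min_eq_left this]; linarith
  · rw [abs_of_nonpos hs]
    have : f xu ≤ f xl := by nlinarith
    rw [min_eq_right this]; linarith

/-- `f̄⁰ = ½(f(x̲) + f(x̄)) + |s|·rad(x)`. [cite: Neumaier1991, Thm 2.4.2, proof of (10b) (the same computation for −f)] -/
theorem f0hi_eq (f : ℝ → ℝ) {xl xu : ℝ} (hx : xl ≤ xu) :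
    f0hi f xl xu = (f xl + f xu) / 2 + |slope f xl xu| * rad xl xu := by
  have h1 := f0lo_eq f hx
  have h2 : f0lo f xl xu + f0hi f xl xu = f xl + f xu := by
    unfold f0lo f0hi; exact min_add_max _ _
  linarith

/-- `(c̄ r − |s|/2)²/c̄ = c̄ r² − |s| r + s²/(4c̄)` for `c̄ ≠ 0` (uses `|s|² = s²`): the vertex value
of the lower parabola, `p(x*, c̄) = ½(f(x̲) + f(x̄)) − c̄ rad(x)² − s²/(4c̄) = f̲⁰ − d̄²/c̄`. [folklore] -/
private theorem vertex_div {cu : ℝ} (hcu : cu ≠ 0) (r s : ℝ) :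
    (cu * r - |s| / 2) ^ 2 / cu = cu * r ^ 2 - |s| * r + s ^ 2 / (4 * cu) := by
  rw [← sq_abs s]
  field_simp
  ring

/-- The lower parabola `p(ξ, c̄) = p(ξ) + c̄ e(ξ)` is bounded below on `x` by (10a): for `d̄ ≤ 0`
its infimum over `x` is at an endpoint (`= f̲⁰`), for `d̄ > 0` at the vertex `x̌ − s/(2c̄)`
(`= f̲⁰ − d̄²/c̄`). [cite: Neumaier1991, Thm 2.4.2, proof of (10a)] -/
theorem pbvLo_le_lowerParabola (f : ℝ → ℝ) {xl xu : ℝ} (hx : xl ≤ xu) (cu : ℝ) {ξ : ℝ}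
    (hξ : ξ ∈ Icc xl xu) : pbvLo f xl xu cu ≤ lin f xl xu ξ + cu * err xl xu ξ := by
  rw [lin_eq_mid, err_eq]
  set s := slope f xl xu with hs
  set r := rad xl xu with hr
  set t := ξ - mid xl xu with ht
  have hr0 : 0 ≤ r := by rw [hr]; unfold rad; linarith
  have htr : |t| ≤ r := by
    rw [ht, hr, abs_le]; unfold mid rad; constructor <;> linarith [hξ.1, hξ.2]
  have hF : f0lo f xl xu = (f xl + f xu) / 2 - |s| * r := f0lo_eq f hx
  have hs2 : |s / 2| = |s| / 2 := by rw [abs_div, abs_two]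
  unfold pbvLo dhi
  rw [← hs, ← hr, hs2]
  split_ifs with hd
  · -- d̄ ≤ 0: the vertex lies outside int(x); the parabola is bounded below by f̲⁰ on x
    rw [hF]
    have hta : 0 ≤ r - |t| := by linarith
    have hst : -(|s| * |t|) ≤ s * t := by rw [← abs_mul]; exact neg_abs_le _
    rcases le_or_gt cu 0 with hcu | hcu
    · have h1 : 0 ≤ cu * (t ^ 2 - r ^ 2) := by
        apply mul_nonneg_of_nonpos_of_nonpos hcu
        nlinarith [abs_nonneg t, sq_abs t]
      nlinarith [abs_nonneg s]
    · have h1 : 0 ≤ (|s| / 2 - cu * r) * (r - |t|) := mul_nonneg (by linarith) hta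
      have h2 : 0 ≤ cu * (r - |t|) ^ 2 := mul_nonneg hcu.le (sq_nonneg _)
      nlinarith [sq_abs t, abs_nonneg s, abs_nonneg t]
  · -- d̄ > 0: c̄ > 0 and the vertex value f̲⁰ − d̄²/c̄ = ½(f(x̲)+f(x̄)) − c̄ rad² − s²/(4c̄)
    have hd' : 0 < cu * r - |s| / 2 := not_le.mp hd
    have hcu : 0 < cu := by
      rcases le_or_gt cu 0 with hle | hlt
      · have : cu * r ≤ 0 := mul_nonpos_of_nonpos_of_nonneg hle hr0
        linarith [abs_nonneg s]
      · exact hlt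
    rw [hF]
    have key := vertex_div hcu.ne' r s
    have hsq : 0 ≤ s * t + cu * t ^ 2 + s ^ 2 / (4 * cu) := by
      have : s * t + cu * t ^ 2 + s ^ 2 / (4 * cu) = (2 * cu * t + s) ^ 2 / (4 * cu) := by
        field_simp; ring
      rw [this]; positivity
    rw [key]; nlinarith

/-- The lower parabola attains the value (10a) at a point of `x` (an endpoint if `d̄ ≤ 0`, the
vertex `x* = x̌ − s/(2c̄) ∈ x` if `d̄ > 0`). [cite: Neumaier1991, Thm 2.4.2, proof of (10a) (inf p*(x, c̄) = p(x*, c̄))] -/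
theorem exists_lowerParabola_eq (f : ℝ → ℝ) {xl xu : ℝ} (hx : xl ≤ xu) (cu : ℝ) :
    ∃ ξ ∈ Icc xl xu, lin f xl xu ξ + cu * err xl xu ξ = pbvLo f xl xu cu := by
  set s := slope f xl xu with hs
  set r := rad xl xu with hr
  have hr0 : 0 ≤ r := by rw [hr]; unfold rad; linarith
  have hs2 : |s / 2| = |s| / 2 := by rw [abs_div, abs_two]
  by_cases hd : dhi f xl xu cu ≤ 0
  · -- an endpoint: e vanishes there and p interpolates f
    have hv : pbvLo f xl xu cu = f0lo f xl xu := by unfold pbvLo; rw [if_pos hd]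
    rcases le_total (f xl) (f xu) with hle | hle
    · refine ⟨xl, ⟨le_rfl, hx⟩, ?_⟩
      rw [hv, lin_left]; unfold f0lo err; rw [min_eq_left hle]; ring
    · refine ⟨xu, ⟨hx, le_rfl⟩, ?_⟩
      rw [hv, lin_right]; unfold f0lo err; rw [min_eq_right hle]; ring
  · have hv : pbvLo f xl xu cu = f0lo f xl xu - dhi f xl xu cu ^ 2 / cu := by
      unfold pbvLo; rw [if_neg hd]
    have hd' : 0 < cu * r - |s| / 2 := by
      have h0 := not_le.mp hd
      unfold dhi at h0; rw [← hs, ← hr, hs2] at h0; exact h0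
    have hcu : 0 < cu := by
      rcases le_or_gt cu 0 with hle | hlt
      · have : cu * r ≤ 0 := mul_nonpos_of_nonpos_of_nonneg hle hr0
        linarith [abs_nonneg s]
      · exact hlt
    -- the vertex x* = x̌ − s/(2c̄) lies in x since |s/(2c̄)| < rad(x)
    have hin : |s / (2 * cu)| ≤ r := by
      rw [abs_div, abs_of_pos (by positivity : (0:ℝ) < 2 * cu), div_le_iff₀ (by positivity)]
      linarith
    refine ⟨mid xl xu - s / (2 * cu), ?_, ?_⟩
    · rw [abs_le] at hin
      unfold mid; rw [hr] at hin; unfold rad at hin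
      constructor <;> linarith [hin.1, hin.2]
    · rw [hv, lin_eq_mid, err_eq, f0lo_eq f hx]
      unfold dhi; rw [← hs, ← hr, hs2]
      have hm : mid xl xu - s / (2 * cu) - mid xl xu = -(s / (2 * cu)) := by ring
      rw [hm, vertex_div hcu.ne' r s]
      field_simp
      ring

/-- `f_p` for `−f` and `−c`: **(10b) is (10a) applied to `−f`** (`s ↦ −s`, `c ↦ −c`, `f̄⁰ ↦ −f̲⁰`).
[cite: Neumaier1991, Thm 2.4.2, proof ("(10b) follows … by applying (10a) to −f in place of f")] -/
theorem pbvHi_eq_neg (f : ℝ → ℝ) (xl xu cl : ℝ) :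
    pbvHi f xl xu cl = -pbvLo (fun ξ => -f ξ) xl xu (-cl) := by
  have hsl : slope (fun ξ => -f ξ) xl xu = -slope f xl xu := by
    rw [slope_def_field, slope_def_field]; ring
  have hd : dhi (fun ξ => -f ξ) xl xu (-cl) = -dlo f xl xu cl := by
    unfold dhi dlo; rw [hsl, neg_div, abs_neg]; ring
  have h0 : f0lo (fun ξ => -f ξ) xl xu = -f0hi f xl xu := by
    unfold f0lo f0hi; exact min_neg_neg _ _
  unfold pbvHi pbvLo
  rw [hd, h0]
  by_cases h : 0 ≤ dlo f xl xu cl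
  · rw [if_pos h, if_pos (by linarith), neg_neg]
  · rw [if_neg h, if_neg (by linarith)]; ring

/-- The second divided difference of `−f` is `−f[·,·,·]`.
[cite: Neumaier1991, Thm 2.4.2, proof (applying (10a) to −f: (9) for −f holds with −c)] -/
theorem secondDividedDiff_neg (f : ℝ → ℝ) (a b c : ℝ) :
    secondDividedDiff (fun ξ => -f ξ) a b c = -secondDividedDiff f a b c := by
  unfold secondDividedDiff; simp only [slope_def_field]; ring

/-- (9) for `−f` with the coefficient interval `−c = [−c̄, −c̲]`.
[cite: Neumaier1991, Thm 2.4.2, proof (applying (10a) to −f in place of f)] -/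
theorem HasSecondDD.neg (h : HasSecondDD f xl xu cl cu) :
    HasSecondDD (fun ξ => -f ξ) xl xu (-cu) (-cl) := by
  intro ξ hξ
  obtain ⟨h1, h2⟩ := h ξ hξ
  rw [secondDividedDiff_neg]
  constructor <;> linarith

/-- The linear interpolant of `−f` is `−p`. [cite: Neumaier1991, Thm 2.4.2, proof (applying (10a) to −f)] -/
theorem lin_neg (f : ℝ → ℝ) (xl xu ξ : ℝ) : lin (fun ζ => -f ζ) xl xu ξ = -lin f xl xu ξ := by
  unfold lin; rw [slope_def_field, slope_def_field]; ring

/-- The upper parabola `p(ξ, c̲)` is bounded above on `x` by (10b).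
[cite: Neumaier1991, Thm 2.4.2, proof of (10b)] -/
theorem upperParabola_le_pbvHi (f : ℝ → ℝ) {xl xu : ℝ} (hx : xl ≤ xu) (cl : ℝ) {ξ : ℝ}
    (hξ : ξ ∈ Icc xl xu) : lin f xl xu ξ + cl * err xl xu ξ ≤ pbvHi f xl xu cl := by
  have h := pbvLo_le_lowerParabola (fun ζ => -f ζ) hx (-cl) hξ
  rw [lin_neg] at h
  rw [pbvHi_eq_neg]; linarith

/-- The upper parabola attains (10b) at a point of `x`. [cite: Neumaier1991, Thm 2.4.2, proof of (10b)] -/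
theorem exists_upperParabola_eq (f : ℝ → ℝ) {xl xu : ℝ} (hx : xl ≤ xu) (cl : ℝ) :
    ∃ ξ ∈ Icc xl xu, lin f xl xu ξ + cl * err xl xu ξ = pbvHi f xl xu cl := by
  obtain ⟨ξ, hξ, h⟩ := exists_lowerParabola_eq (fun ζ => -f ζ) hx (-cl)
  refine ⟨ξ, hξ, ?_⟩
  rw [lin_neg] at h
  rw [pbvHi_eq_neg]; linarith

/-- **Theorem 2.4.2 (11)**, first inclusion, lower half: `inf f_p(x) ≤ f(x̃)` for all `x̃ ∈ x`.
[cite: Neumaier1991, Thm 2.4.2 (11) (f*(x) ⊆ f_p(x))] -/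
theorem pbvLo_le (hx : xl < xu) (h : HasSecondDD f xl xu cl cu) {ξ : ℝ} (hξ : ξ ∈ Icc xl xu) :
    pbvLo f xl xu cu ≤ f ξ := by
  have hd := hasDecomp_of_hasSecondDD hx h
  have h1 := (sandwich_of_nonpos hd (fun ζ hζ => err_nonpos hζ) hξ).1
  have h2 := pbvLo_le_lowerParabola f hx.le cu hξ
  unfold pc at h1
  linarith

/-- **Theorem 2.4.2 (11)**, first inclusion, upper half: `f(x̃) ≤ sup f_p(x)` for all `x̃ ∈ x`.
[cite: Neumaier1991, Thm 2.4.2 (11) (f*(x) ⊆ f_p(x))] -/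
theorem le_pbvHi (hx : xl < xu) (h : HasSecondDD f xl xu cl cu) {ξ : ℝ} (hξ : ξ ∈ Icc xl xu) :
    f ξ ≤ pbvHi f xl xu cl := by
  have hd := hasDecomp_of_hasSecondDD hx h
  have h1 := (sandwich_of_nonpos hd (fun ζ hζ => err_nonpos hζ) hξ).2
  have h2 := upperParabola_le_pbvHi f hx.le cl hξ
  unfold pc at h1
  linarith

/-- **Theorem 2.4.2 (11)**, first inclusion: `f*(x) ⊆ f_p(x)`. [cite: Neumaier1991, Thm 2.4.2 (11)] -/
theorem range_subset_pbv (hx : xl < xu) (h : HasSecondDD f xl xu cl cu) :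
    f '' Icc xl xu ⊆ Icc (pbvLo f xl xu cu) (pbvHi f xl xu cl) := by
  rintro _ ⟨ξ, hξ, rfl⟩
  exact ⟨pbvLo_le hx h hξ, le_pbvHi hx h hξ⟩

/-- **Theorem 2.4.2 (11)**, second inclusion, lower half: some `x_* ∈ x` has
`f(x_*) ≤ inf f_p(x) + 2·rad(c)·rad(x)²`. [cite: Neumaier1991, Thm 2.4.2 (11) (f_p(x) ⊆ f*(x) + 2rad(c)rad(x)²[−1, 1]); Thm 2.4.1 (5)] -/
theorem exists_le_pbvLo_add (hx : xl < xu) (h : HasSecondDD f xl xu cl cu) :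
    ∃ ξ ∈ Icc xl xu, f ξ ≤ pbvLo f xl xu cu + (cu - cl) * rad xl xu ^ 2 := by
  have hd := hasDecomp_of_hasSecondDD hx h
  have hcc := cl_le_cu_of_hasSecondDD hx h
  obtain ⟨ξ, hξ, hv⟩ := exists_lowerParabola_eq f hx.le cu
  refine ⟨ξ, hξ, ?_⟩
  have h1 := (sandwich_of_nonpos hd (fun ζ hζ => err_nonpos hζ) hξ).2
  unfold pc at h1
  have h2 : (cl - cu) * err xl xu ξ ≤ (cu - cl) * rad xl xu ^ 2 := by
    have := abs_err_le hξ
    rw [abs_of_nonpos (err_nonpos hξ)] at this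
    nlinarith
  linarith

/-- **Theorem 2.4.2 (11)**, second inclusion, upper half: some `x* ∈ x` has
`f(x*) ≥ sup f_p(x) − 2·rad(c)·rad(x)²`. [cite: Neumaier1991, Thm 2.4.2 (11); Thm 2.4.1 (5)] -/
theorem exists_ge_pbvHi_sub (hx : xl < xu) (h : HasSecondDD f xl xu cl cu) :
    ∃ ξ ∈ Icc xl xu, pbvHi f xl xu cl - (cu - cl) * rad xl xu ^ 2 ≤ f ξ := by
  have hd := hasDecomp_of_hasSecondDD hx h
  have hcc := cl_le_cu_of_hasSecondDD hx h
  obtain ⟨ξ, hξ, hv⟩ := exists_upperParabola_eq f hx.le cl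
  refine ⟨ξ, hξ, ?_⟩
  have h1 := (sandwich_of_nonpos hd (fun ζ hζ => err_nonpos hζ) hξ).1
  unfold pc at h1
  have h2 : (cu - cl) * err xl xu ξ ≥ -((cu - cl) * rad xl xu ^ 2) := by
    have := abs_err_le hξ
    rw [abs_of_nonpos (err_nonpos hξ)] at this
    nlinarith
  linarith

/-- **Theorem 2.4.2 (11)** on hulls, as a `q`-distance (Prop 1.7.1 (2)):
`q(f_p(x), □f*(x)) ≤ 2·rad(c)·rad(x)²`. [cite: Neumaier1991, Thm 2.4.2 (11); Prop 1.7.1 (2)] -/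
theorem dist_pbv_range_le (hx : xl < xu) (h : HasSecondDD f xl xu cl cu) :
    max |pbvLo f xl xu cu - rangeInf f xl xu| |pbvHi f xl xu cl - rangeSup f xl xu|
      ≤ (cu - cl) * rad xl xu ^ 2 := by
  have hne : (f '' Icc xl xu).Nonempty := ⟨f xl, xl, ⟨le_rfl, hx.le⟩, rfl⟩
  have hr : BddBelow (f '' Icc xl xu) := ⟨_, fun _ hy => (range_subset_pbv hx h hy).1⟩
  have hr' : BddAbove (f '' Icc xl xu) := ⟨_, fun _ hy => (range_subset_pbv hx h hy).2⟩
  have h1 : pbvLo f xl xu cu ≤ rangeInf f xl xu :=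
    le_csInf hne (by rintro _ ⟨ξ, hξ, rfl⟩; exact pbvLo_le hx h hξ)
  have h2 : rangeSup f xl xu ≤ pbvHi f xl xu cl :=
    csSup_le hne (by rintro _ ⟨ξ, hξ, rfl⟩; exact le_pbvHi hx h hξ)
  obtain ⟨ξ1, hξ1, hf1⟩ := exists_le_pbvLo_add hx h
  obtain ⟨ξ2, hξ2, hf2⟩ := exists_ge_pbvHi_sub hx h
  have h3 : rangeInf f xl xu ≤ f ξ1 := csInf_le hr ⟨ξ1, hξ1, rfl⟩
  have h4 : f ξ2 ≤ rangeSup f xl xu := le_csSup hr' ⟨ξ2, hξ2, rfl⟩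
  refine max_le ?_ ?_
  · rw [abs_sub_comm, abs_of_nonneg (by linarith)]; linarith
  · rw [abs_of_nonneg (by linarith)]; linarith

/-- Remark (iv) **(14)**: `0 ≤ rad f_p(x) − rad □f*(x) ≤ 2·rad(c)·rad(x)²` — the parabolic
boundary value form has cubic approximation order when `rad(c) = O(rad(x))`.
[cite: Neumaier1991, §2.4 (14) (Remark (iv) after Thm 2.4.2)] -/
theorem cubicApproximation (hx : xl < xu) (h : HasSecondDD f xl xu cl cu) :
    0 ≤ (pbvHi f xl xu cl - pbvLo f xl xu cu) / 2 - (rangeSup f xl xu - rangeInf f xl xu) / 2 ∧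
      (pbvHi f xl xu cl - pbvLo f xl xu cu) / 2 - (rangeSup f xl xu - rangeInf f xl xu) / 2
        ≤ (cu - cl) * rad xl xu ^ 2 := by
  have hne : (f '' Icc xl xu).Nonempty := ⟨f xl, xl, ⟨le_rfl, hx.le⟩, rfl⟩
  have hr : BddBelow (f '' Icc xl xu) := ⟨_, fun _ hy => (range_subset_pbv hx h hy).1⟩
  have hr' : BddAbove (f '' Icc xl xu) := ⟨_, fun _ hy => (range_subset_pbv hx h hy).2⟩
  have h1 : pbvLo f xl xu cu ≤ rangeInf f xl xu :=
    le_csInf hne (by rintro _ ⟨ξ, hξ, rfl⟩; exact pbvLo_le hx h hξ)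
  have h2 : rangeSup f xl xu ≤ pbvHi f xl xu cl :=
    csSup_le hne (by rintro _ ⟨ξ, hξ, rfl⟩; exact le_pbvHi hx h hξ)
  obtain ⟨ξ1, hξ1, hf1⟩ := exists_le_pbvLo_add hx h
  obtain ⟨ξ2, hξ2, hf2⟩ := exists_ge_pbvHi_sub hx h
  have h3 : rangeInf f xl xu ≤ f ξ1 := csInf_le hr ⟨ξ1, hξ1, rfl⟩
  have h4 : f ξ2 ≤ rangeSup f xl xu := le_csSup hr' ⟨ξ2, hξ2, rfl⟩
  constructor <;> linarith

/-- Remark (ii) **(12)**: the two parabolae enclose `f` pointwise on `x`,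
`f(x̃) ∈ [p(x̃, c̄), p(x̃, c̲)]`. [cite: Neumaier1991, §2.4 (12) (Remark (ii) after Thm 2.4.2)] -/
theorem parabola_sandwich (hx : xl < xu) (h : HasSecondDD f xl xu cl cu) {ξ : ℝ}
    (hξ : ξ ∈ Icc xl xu) :
    lin f xl xu ξ + cu * err xl xu ξ ≤ f ξ ∧ f ξ ≤ lin f xl xu ξ + cl * err xl xu ξ := by
  have h1 := sandwich_of_nonpos (hasDecomp_of_hasSecondDD hx h) (fun ζ hζ => err_nonpos hζ) hξ
  unfold pc at h1
  exact h1

/-- Remark (iii) **(13)**: if `2|c|rad(x) ≤ |f[x̲, x̄]|` (`|c| = max(|c̲|, |c̄|)`) then both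
parabolae have their extrema at the endpoints, `f_p(x) = f⁰`.
[cite: Neumaier1991, §2.4 (13) (Remark (iii) after Thm 2.4.2: f_p(x) = f⁰)] -/
theorem pbv_eq_f0_of_steep (hx : xl ≤ xu)
    (h13 : 2 * max |cl| |cu| * rad xl xu ≤ |slope f xl xu|) :
    pbvLo f xl xu cu = f0lo f xl xu ∧ pbvHi f xl xu cl = f0hi f xl xu := by
  have hr : 0 ≤ rad xl xu := by unfold rad; linarith
  have hs2 : |slope f xl xu / 2| = |slope f xl xu| / 2 := by rw [abs_div, abs_two]
  have hcu : cu * rad xl xu ≤ max |cl| |cu| * rad xl xu :=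
    mul_le_mul_of_nonneg_right (le_trans (le_abs_self cu) (le_max_right _ _)) hr
  have hcl : -(max |cl| |cu|) * rad xl xu ≤ cl * rad xl xu :=
    mul_le_mul_of_nonneg_right (by linarith [neg_abs_le cl, le_max_left |cl| |cu|]) hr
  have hd1 : dhi f xl xu cu ≤ 0 := by unfold dhi; rw [hs2]; nlinarith
  have hd2 : 0 ≤ dlo f xl xu cl := by unfold dlo; rw [hs2]; nlinarith
  unfold pbvLo pbvHi
  rw [if_pos hd1, if_pos hd2]
  exact ⟨rfl, rfl⟩

/-- Remark (iii): under (13) the range is computed without overestimation — `inf f_p(x) = f̲⁰`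
is the least element of `f*(x)`. [cite: Neumaier1991, §2.4 (13) (Remark (iii): f_p(x) = f⁰ = f*(x))] -/
theorem isLeast_range_of_steep (hx : xl < xu) (h : HasSecondDD f xl xu cl cu)
    (h13 : 2 * max |cl| |cu| * rad xl xu ≤ |slope f xl xu|) :
    IsLeast (f '' Icc xl xu) (pbvLo f xl xu cu) := by
  have he := (pbv_eq_f0_of_steep (f := f) hx.le h13).1
  refine ⟨?_, ?_⟩
  · rw [he]; unfold f0lo
    rcases le_total (f xl) (f xu) with hle | hle
    · exact ⟨xl, ⟨le_rfl, hx.le⟩, (min_eq_left hle).symm⟩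
    · exact ⟨xu, ⟨hx.le, le_rfl⟩, (min_eq_right hle).symm⟩
  · rintro _ ⟨ξ, hξ, rfl⟩
    exact pbvLo_le hx h hξ

/-- Remark (iii): under (13), `sup f_p(x) = f̄⁰` is the greatest element of `f*(x)`.
[cite: Neumaier1991, §2.4 (13) (Remark (iii): f_p(x) = f⁰ = f*(x))] -/
theorem isGreatest_range_of_steep (hx : xl < xu) (h : HasSecondDD f xl xu cl cu)
    (h13 : 2 * max |cl| |cu| * rad xl xu ≤ |slope f xl xu|) :
    IsGreatest (f '' Icc xl xu) (pbvHi f xl xu cl) := by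
  have he := (pbv_eq_f0_of_steep (f := f) hx.le h13).2
  refine ⟨?_, ?_⟩
  · rw [he]; unfold f0hi
    rcases le_total (f xl) (f xu) with hle | hle
    · exact ⟨xu, ⟨hx.le, le_rfl⟩, (max_eq_right hle).symm⟩
    · exact ⟨xl, ⟨le_rfl, hx.le⟩, (max_eq_left hle).symm⟩
  · rintro _ ⟨ξ, hξ, rfl⟩
    exact le_pbvHi hx h hξ

/-- Remark (iv): for `f` continuous on `x` and twice differentiable inside, an enclosure
`f''(ζ) ∈ [g̲, ḡ]` on `int(x)` gives (9) with `c = ½[g̲, ḡ]` (by the generalised mean value theorem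
`f[x̲, x̃, x̄] = ½ f''(ζ)`, (7)). [cite: Neumaier1991, §2.4 (7) and Remark (iv) after Thm 2.4.2 (c = ½ f''(x))] -/
theorem hasSecondDD_of_deriv2 (hf : ContinuousOn f (Icc xl xu))
    (hf' : ∀ ζ ∈ Ioo xl xu, DifferentiableAt ℝ f ζ)
    (hf'' : ∀ ζ ∈ Ioo xl xu, DifferentiableAt ℝ (deriv f) ζ) {gl gu : ℝ}
    (hg : ∀ ζ ∈ Ioo xl xu, deriv (deriv f) ζ ∈ Icc gl gu) :
    HasSecondDD f xl xu (gl / 2) (gu / 2) := by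
  intro ξ hξ
  obtain ⟨ζ, hζ, hval⟩ := exists_secondDividedDiff_eq hξ.1 hξ.2 hf hf' hf''
  obtain ⟨h1, h2⟩ := hg ζ hζ
  rw [hval]
  constructor <;> linarith

/-- **Theorem 2.4.2 through Theorem 2.4.1**: with `p` the linear interpolant and
`e(ξ) = (ξ − x̲)(ξ − x̄)` (continuous), `e*(x) ≤ 0` and `|e*(x)| = rad(x)²`, the general bound (5)
specialises to `q ≤ 2·rad(c)·rad(x)²` for the interpolation form (2) = (6) — the printed route to
(11). [cite: Neumaier1991, Thm 2.4.2, proof ("the overestimation bound (5) yields (11)")] -/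
theorem dist_ip_range_le_parabolic (hx : xl < xu) (h : HasSecondDD f xl xu cl cu) :
    max |ipLo (lin f xl xu) (err xl xu) xl xu cl cu - rangeInf f xl xu|
        |ipHi (lin f xl xu) (err xl xu) xl xu cl cu - rangeSup f xl xu|
      ≤ (cu - cl) * rad xl xu ^ 2 := by
  have hp : ContinuousOn (lin f xl xu) (Icc xl xu) := by
    unfold lin; fun_prop
  have he : ContinuousOn (err xl xu) (Icc xl xu) := by
    unfold err; fun_prop
  exact dist_ip_range_le hx.le (hasDecomp_of_hasSecondDD hx h) hp he (fun ξ hξ => abs_err_le hξ)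

/-- The interpolation form (2) for the parabolic data coincides with the closed form (10):
`inf f_p(x) = inf p*(x, c̄)` ((6)) `= (10a)`. [cite: Neumaier1991, Thm 2.4.2, proof ("it only remains to check the closed expression (10) for (6)")] -/
theorem ipLo_parabolic_eq (hx : xl < xu) (hcc : cl ≤ cu) :
    ipLo (lin f xl xu) (err xl xu) xl xu cl cu = pbvLo f xl xu cu := by
  have hp : ContinuousOn (lin f xl xu) (Icc xl xu) := by unfold lin; fun_prop
  have he : ContinuousOn (err xl xu) (Icc xl xu) := by unfold err; fun_prop
  have hcont : ∀ c : ℝ, ContinuousOn (pc (lin f xl xu) (err xl xu) c) (Icc xl xu) := fun c =>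
    hp.add (continuousOn_const.mul he)
  rw [ipLo_eq_of_nonpos hx.le hcc (fun ζ hζ => err_nonpos hζ)
    (isCompact_Icc.bddBelow_image (hcont cl)) (isCompact_Icc.bddBelow_image (hcont cu))]
  obtain ⟨ξ0, hξ0, hv⟩ := exists_lowerParabola_eq f hx.le cu
  refine IsLeast.csInf_eq ⟨⟨ξ0, hξ0, hv⟩, ?_⟩
  rintro _ ⟨ξ, hξ, rfl⟩
  exact pbvLo_le_lowerParabola f hx.le cu hξ

/-- `sup f_p(x) = sup p*(x, c̲)` ((6)) `= (10b)`. [cite: Neumaier1991, Thm 2.4.2, proof ("it only remains to check the closed expression (10) for (6)")] -/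
theorem ipHi_parabolic_eq (hx : xl < xu) (hcc : cl ≤ cu) :
    ipHi (lin f xl xu) (err xl xu) xl xu cl cu = pbvHi f xl xu cl := by
  have hp : ContinuousOn (lin f xl xu) (Icc xl xu) := by unfold lin; fun_prop
  have he : ContinuousOn (err xl xu) (Icc xl xu) := by unfold err; fun_prop
  have hcont : ∀ c : ℝ, ContinuousOn (pc (lin f xl xu) (err xl xu) c) (Icc xl xu) := fun c =>
    hp.add (continuousOn_const.mul he)
  rw [ipHi_eq_of_nonpos hx.le hcc (fun ζ hζ => err_nonpos hζ)
    (isCompact_Icc.bddAbove_image (hcont cl)) (isCompact_Icc.bddAbove_image (hcont cu))]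
  obtain ⟨ξ0, hξ0, hv⟩ := exists_upperParabola_eq f hx.le cl
  refine IsGreatest.csSup_eq ⟨⟨ξ0, hξ0, hv⟩, ?_⟩
  rintro _ ⟨ξ, hξ, rfl⟩
  exact upperParabola_le_pbvHi f hx.le cl hξ

end Literature.Analysis.ValidatedNumerics.InterpolationForm

end
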